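import Mathlib
import Summits.ResolutionOfSingularities.ResolutionOfSingularities.Theorems.WeightedInvariantIotaOrder
import HarnessLib

/-!
# Kernel specimen: the `𝔪`-adic order JUMPS UP under generization at a singular point — the quadric cone
# `k[x,y,z]/(xy − z²)` (door `HypersurfaceCentreConstruction`, stmt-ResolutionOfSingularities-19897, route
# `WeightedInvariant`; design points (c7)/(c8) of the H2a‴ clause module `WeightedInvariantHypersurfaceLocalGameEFT3`)

[OURS · L1 W4.3 · cell `res-hironaka`, HUMAN RULING D-0089] Helper file `--supports stmt-ResolutionOfSingularities-19897`
— KERNEL DOCUMENTATION OF A DESIGN POINT, in the manner of `…CentreFiltrationNotDeterminedByCentre` for (c9′).  No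
statement of the manuscript under review (Hironaka 2017) is typed or used here, nothing is attributed to its author, and
nothing here is a claim about resolution of singularities.  AI-produced, weaker than expert review.  Typer: res-type-097
(reserve volunteer, TAKING-UNLESS-OBJECTED 2026-08-27T05:15:53Z, unobjected).  PRIORITY OF THE REMARK: the cone remark
on (c7)/(c8) was posted first by res-type-039 (05:07:50Z/05:08:09Z) and res-D-pv-002 (05:08:12Z) and adopted by
res-L1-w43-plan-1 (CRUX-PLAN §v6.8 addendum 7, 05:13:43Z): in the TREE (`…HypersurfaceLocalGameEFT3`, p501595) clause
(c7) `IotaGenerizationMonotone` quantifies over REGULAR local rings only and (c8) `IotaUpperSemicontinuous` over SMOOTH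
quasi-compact `Y` only.  This file is the kernel evidence behind those two restrictions («on singular schemes order-type
functions need not be u.s.c.», docstring of (c8)); it changes no clause and touches no registered skeleton.

THE COMPUTATION (every field `k`).
* `A = k[x,y,z]/(xy − z²)`, ruling `𝔭 = ker (A → k[T]; x, z ↦ 0, y ↦ T)` (`= (x, z)`), vertex
  `𝔪 = ker (A → k; x, y, z ↦ 0)` (`= (x, y, z)`), `𝔭 ≤ 𝔪`, element `x`;
* `x ∈ 𝔪(A_𝔭)²` — in `A_𝔭` the element `y` is a unit and `x = z²·y⁻¹` (`x_mem_sq_of_atRuling`, from the generic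
  mechanism `algebraMap_mem_maximalIdeal_sq_of_mul_eq_sq`: `f·u = v²`, `u ∉ 𝔭`, `v ∈ 𝔭`);
* `x ∉ 𝔪(A_𝔪)²` — the `k`-algebra map `A → k[ε]`, `x ↦ ε`, `y, z ↦ 0` kills `xy − z²`, sends `A ∖ 𝔪` to units and
  `𝔪²` to `(ε)² = 0`, but `x ↦ ε ≠ 0` (`x_not_mem_sq_of_atVertex`);
* hence with `S := A_𝔪` (`VertexLocalRing`, the local ring of the cone at its vertex) and its prime `𝔭' = 𝔭A_𝔪`
  (`rulingAtVertex`): `ord_S(x) = 1` and `ord_{S_𝔭'}(x) ≥ 2` (`coneVertex_generization_jump`; read through ORDER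
  (o11)'s tree function: `iotaOrd_x_atVertex`, `two_le_iotaOrd_x_atRulingAtVertex`).  (The order at `𝔭` is EXACTLY 2 —
  test map `A → k(T)⟦ε⟧`, `x ↦ T⁻¹ε²`, `y ↦ T`, `z ↦ ε`; kept out of this file for length.)
CONSEQUENCES. `not_generizationMonotone_allRings_iotaOrd`: the ALL-RINGS form of the generization clause fails for
`iotaOrd` — whereas the tree's restricted (c7) holds for it (`iotaOrd_generizationMonotone`, res-type-073); so the
hypothesis `[IsRegularLocalRing S]` in (c7) is NECESSARY.  `not_isRegularLocalRing_vertexLocalRing`: the vertex is a singular point,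
proved BY the order jump and the regular-ring clause.  Scheme-level reading for (c8) (not formalised here): on
`Spec A` the super-level set `{2 ≤ ord(x)}` contains the generic point of the ruling `V(x, z)` but not its
specialisation, the vertex — it is not closed; the tree's (c8) on smooth `Y` is `…OrderSemicontinuousSmooth` /
`…IotaOrderSemicontinuous` (res-type-039).
-/
noncomputable section

set_option linter.dupNamespace false -- mandated namespace `Summit.<Summit>.<Problem>` of this single-conjunct summit

open IsLocalRing MvPolynomial

namespace Summit.ResolutionOfSingularities.ResolutionOfSingularities.Cruxes.HypersurfaceCentreConstruction.LocalEngine.ConeSpecimen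

variable (k : Type) [Field k]

/-- [OURS] The defining relation `X₀·X₁ − X₂²` of the quadric cone in `k[X₀, X₁, X₂]`. -/
def coneRel : MvPolynomial (Fin 3) k := X 0 * X 1 - X 2 ^ 2

/-- [OURS] The coordinate ring `A = k[X₀,X₁,X₂]/(X₀X₁ − X₂²)` of the quadric cone (a normal surface, singular
exactly at the vertex). -/
abbrev ConeRing : Type := MvPolynomial (Fin 3) k ⧸ Ideal.span {coneRel k}

/-- [OURS] The class `x` of `X₀` in the cone ring. -/
def x : ConeRing k := Ideal.Quotient.mk _ (X 0)

/-- [OURS] The class `y` of `X₁` in the cone ring. -/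
def y : ConeRing k := Ideal.Quotient.mk _ (X 1)

/-- [OURS] The class `z` of `X₂` in the cone ring. -/
def z : ConeRing k := Ideal.Quotient.mk _ (X 2)

/-- The cone relation `x·y = z²` in `A`. -/
theorem x_mul_y : x k * y k = z k ^ 2 := by
  simp only [x, y, z, ← map_mul, ← map_pow]
  exact (Ideal.Quotient.eq.mpr (Ideal.subset_span rfl))

/-- [OURS] The ruling homomorphism `A → k[T]`, `x ↦ 0`, `y ↦ T`, `z ↦ 0` (its kernel is the prime `(x, z)`, the
generic point of the line `V(x, z)` on the cone). -/
def rulingHom : ConeRing k →ₐ[k] Polynomial k :=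
  Ideal.Quotient.liftₐ (Ideal.span {coneRel k}) (MvPolynomial.aeval ![0, Polynomial.X, 0]) (by
    intro a ha
    obtain ⟨c, rfl⟩ := Ideal.mem_span_singleton'.mp ha
    simp [coneRel])

/-- [OURS] The vertex homomorphism `A → k`, `x, y, z ↦ 0` (its kernel is the maximal ideal `(x, y, z)`). -/
def vertexHom : ConeRing k →ₐ[k] k :=
  Ideal.Quotient.liftₐ (Ideal.span {coneRel k}) (MvPolynomial.aeval 0) (by
    intro a ha
    obtain ⟨c, rfl⟩ := Ideal.mem_span_singleton'.mp ha
    simp [coneRel])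

/-- [OURS] The ruling prime `𝔭 = (x, z) ⊂ A` (as the kernel of `rulingHom`). -/
def ruling : Ideal (ConeRing k) := RingHom.ker (rulingHom k).toRingHom

/-- [OURS] The vertex `𝔪 = (x, y, z) ⊂ A` (as the kernel of `vertexHom`). -/
def vertex : Ideal (ConeRing k) := RingHom.ker (vertexHom k).toRingHom

/-- `𝔭` is prime. -/
instance ruling_isPrime : (ruling k).IsPrime := RingHom.ker_isPrime _

/-- `𝔪` is prime. -/
instance vertex_isPrime : (vertex k).IsPrime := RingHom.ker_isPrime _

/-- `x ↦ 0` along the ruling. -/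
@[simp] theorem rulingHom_x : rulingHom k (x k) = 0 := by
  simp [rulingHom, x]

/-- `y ↦ T` along the ruling. -/
@[simp] theorem rulingHom_y : rulingHom k (y k) = Polynomial.X := by
  simp [rulingHom, y]

/-- `z ↦ 0` along the ruling. -/
@[simp] theorem rulingHom_z : rulingHom k (z k) = 0 := by
  simp [rulingHom, z]

/-- `x ↦ 0` at the vertex. -/
@[simp] theorem vertexHom_x : vertexHom k (x k) = 0 := by
  simp [vertexHom, x]

/-- The vertex map factors through the ruling map: `vertexHom = (T ↦ 0) ∘ rulingHom`. -/
theorem vertexHom_eq_comp :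
    vertexHom k = (Polynomial.aeval (0 : k)).comp (rulingHom k) := by
  apply Ideal.Quotient.algHom_ext
  apply MvPolynomial.algHom_ext
  intro i
  fin_cases i <;> simp [vertexHom, rulingHom]

/-- The ruling specialises to the vertex: `𝔭 ≤ 𝔪`. -/
theorem ruling_le_vertex : ruling k ≤ vertex k := by
  intro a ha
  simp only [ruling, vertex, RingHom.mem_ker, AlgHom.toRingHom_eq_coe, RingHom.coe_coe] at ha ⊢
  rw [vertexHom_eq_comp, AlgHom.comp_apply, ha, map_zero]

/-- `x ∈ 𝔭`. -/
theorem x_mem_ruling : x k ∈ ruling k := by simp [ruling, RingHom.mem_ker]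

/-- `z ∈ 𝔭`. -/
theorem z_mem_ruling : z k ∈ ruling k := by simp [ruling, RingHom.mem_ker]

/-- `y ∉ 𝔭`. -/
theorem y_not_mem_ruling : y k ∉ ruling k := by
  simp [ruling, RingHom.mem_ker, Polynomial.X_ne_zero]

/-- `x ∈ 𝔪`. -/
theorem x_mem_vertex : x k ∈ vertex k := by simp [vertex, RingHom.mem_ker]

section AtRuling

/-- GENERIC ORDER-JUMP MECHANISM: if `f·u = v²` with `u ∉ 𝔭` and `v ∈ 𝔭`, then in any localization at the prime `𝔭`
the image of `f` lies in the square of the maximal ideal (`u` becomes a unit, `f = v²·u⁻¹`). -/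
theorem algebraMap_mem_maximalIdeal_sq_of_mul_eq_sq {S : Type*} [CommRing S] (𝔭 : Ideal S) [𝔭.IsPrime]
    (T : Type*) [CommRing T] [Algebra S T] [IsLocalization.AtPrime T 𝔭]
    {f u v : S} (h : f * u = v ^ 2) (hu : u ∉ 𝔭) (hv : v ∈ 𝔭)
    (hT : IsLocalRing T := IsLocalization.AtPrime.isLocalRing T 𝔭) :
    algebraMap S T f ∈ (maximalIdeal T) ^ 2 := by
  obtain ⟨w, hw⟩ := IsLocalization.map_units T (⟨u, hu⟩ : 𝔭.primeCompl)
  have hv' : algebraMap S T v ∈ maximalIdeal T :=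
    (IsLocalization.AtPrime.to_map_mem_maximal_iff T 𝔭 v).mpr hv
  have hfu : algebraMap S T f * w = algebraMap S T v ^ 2 := by
    rw [hw, ← map_mul, h, map_pow]
  have hf : algebraMap S T f = algebraMap S T v ^ 2 * ↑w⁻¹ := by
    rw [← hfu, Units.mul_inv_cancel_right]
  rw [hf]
  exact Ideal.mul_mem_right _ _ (Ideal.pow_mem_pow hv' 2)

variable (L : Type*) [CommRing L] [Algebra (ConeRing k) L] [IsLocalization.AtPrime L (ruling k)]

/-- ORDER JUMPS UP ALONG THE RULING: in any localization `A_𝔭` of the cone ring at the ruling prime `𝔭 = (x, z)`,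
the element `x` lies in the square of the maximal ideal (`y` is a unit there and `x = z²·y⁻¹`), i.e.
`ord_𝔭(x) ≥ 2`. -/
theorem x_mem_sq_of_atRuling (hL : IsLocalRing L := IsLocalization.AtPrime.isLocalRing L (ruling k)) :
    algebraMap (ConeRing k) L (x k) ∈ (maximalIdeal L) ^ 2 :=
  algebraMap_mem_maximalIdeal_sq_of_mul_eq_sq (ruling k) L (x_mul_y k) (y_not_mem_ruling k) (z_mem_ruling k) hL

end AtRuling

section AtVertex

/-- [OURS] The test map `k[X₀,X₁,X₂] → k[ε]`, `X₀ ↦ ε`, `X₁, X₂ ↦ 0`. -/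
def toDualPoly : MvPolynomial (Fin 3) k →ₐ[k] DualNumber k :=
  MvPolynomial.aeval ![DualNumber.eps, 0, 0]

/-- The test map kills the cone relation. -/
theorem toDualPoly_coneRel : toDualPoly k (coneRel k) = 0 := by
  simp [toDualPoly, coneRel]

/-- [OURS] The test map on the cone ring `A → k[ε]`, `x ↦ ε`, `y, z ↦ 0`. -/
def toDual : ConeRing k →ₐ[k] DualNumber k :=
  Ideal.Quotient.liftₐ (Ideal.span {coneRel k}) (toDualPoly k) (by
    intro a ha
    obtain ⟨c, rfl⟩ := Ideal.mem_span_singleton'.mp ha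
    rw [map_mul, toDualPoly_coneRel, mul_zero])

/-- `x ↦ ε` under the test map. -/
@[simp] theorem toDual_x : toDual k (x k) = DualNumber.eps := by
  simp [toDual, toDualPoly, x]

/-- The constant term of the test map is the vertex evaluation. -/
theorem fst_comp_toDual :
    (TrivSqZeroExt.fstHom k k k).comp (toDual k) = vertexHom k := by
  apply Ideal.Quotient.algHom_ext
  apply MvPolynomial.algHom_ext
  intro i
  fin_cases i <;> simp [vertexHom, toDual, toDualPoly]

/-- Pointwise form of `fst_comp_toDual`. -/
theorem fst_toDual (a : ConeRing k) : (toDual k a).fst = vertexHom k a := by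
  have h := congrArg (fun φ : ConeRing k →ₐ[k] k => φ a) (fst_comp_toDual k)
  simpa using h

/-- Elements off the vertex go to units of `k[ε]`. -/
theorem isUnit_toDual (s : (vertex k).primeCompl) : IsUnit ((toDual k).toRingHom s) := by
  rw [AlgHom.toRingHom_eq_coe, RingHom.coe_coe, TrivSqZeroExt.isUnit_iff_isUnit_fst, fst_toDual,
    isUnit_iff_ne_zero]
  have hs : (s : ConeRing k) ∉ vertex k := s.2
  simpa [vertex, RingHom.mem_ker] using hs

/-- The vertex ideal goes into the square-zero ideal `(ε)` = `ker fst`. -/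
theorem toDual_mem_ker_fst {a : ConeRing k} (ha : a ∈ vertex k) : (toDual k a).fst = 0 := by
  rw [fst_toDual]
  simpa [vertex, RingHom.mem_ker] using ha

/-- The square of the vertex ideal dies under the test map. -/
theorem map_toDual_vertex_sq : ((vertex k) ^ 2).map (toDual k).toRingHom = ⊥ := by
  rw [Ideal.map_pow, eq_bot_iff, pow_two, Ideal.mul_le]
  intro a ha b hb
  rw [Ideal.mem_bot]
  -- `a`, `b` lie in the image ideal of the vertex, hence have zero constant term
  have hfst : ∀ c ∈ (vertex k).map (toDual k).toRingHom, TrivSqZeroExt.fst c = 0 := by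
    intro c hc
    refine Submodule.span_induction ?_ ?_ ?_ ?_ hc
    · rintro _ ⟨d, hd, rfl⟩
      exact toDual_mem_ker_fst k hd
    · simp
    · intro c d _ _ hc hd
      simp [hc, hd]
    · intro r c _ hc
      simp [hc]
  have ha0 := hfst a ha
  have hb0 := hfst b hb
  ext
  · simp [ha0, hb0]
  · simp [TrivSqZeroExt.snd_mul, ha0, hb0]

variable (M : Type*) [CommRing M] [Algebra (ConeRing k) M] [IsLocalization.AtPrime M (vertex k)]

/-- ORDER ONE AT THE VERTEX: in any localization `A_𝔪` of the cone ring at the vertex `𝔪 = (x, y, z)`, the element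
`x` does NOT lie in the square of the maximal ideal (`x, y, z` is a basis of `𝔪/𝔪²`), i.e. `ord_𝔪(x) = 1`. -/
theorem x_not_mem_sq_of_atVertex (hM : IsLocalRing M := IsLocalization.AtPrime.isLocalRing M (vertex k)) :
    algebraMap (ConeRing k) M (x k) ∉ (maximalIdeal M) ^ 2 := by
  intro hx
  -- the test map extends to the localization
  let θ : M →+* DualNumber k := IsLocalization.lift (M := (vertex k).primeCompl) (isUnit_toDual k)
  have hθ : θ.comp (algebraMap (ConeRing k) M) = (toDual k).toRingHom :=
    IsLocalization.lift_comp (M := (vertex k).primeCompl) (isUnit_toDual k)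
  -- the maximal ideal of `M` is the extension of the vertex
  have hmax : maximalIdeal M = (vertex k).map (algebraMap (ConeRing k) M) := by
    have h := IsLocalization.AtPrime.under_maximalIdeal M (vertex k)
    rw [← h, IsLocalization.map_under (vertex k).primeCompl M]
  rw [hmax, ← Ideal.map_pow] at hx
  have h1 : θ (algebraMap (ConeRing k) M (x k)) ∈ ((vertex k) ^ 2).map (θ.comp (algebraMap _ M)) := by
    rw [← Ideal.map_map]
    exact Ideal.mem_map_of_mem _ hx
  rw [hθ, map_toDual_vertex_sq, Ideal.mem_bot, ← RingHom.comp_apply, hθ] at h1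
  have h2 : DualNumber.eps (R := k) = 0 := by simpa using h1
  have h3 := congrArg TrivSqZeroExt.snd h2
  simp at h3

end AtVertex

/-- [OURS] The local ring `A_𝔪` of the cone at its vertex (local, noetherian, essentially of finite type over `k`,
NOT regular) — a type synonym of `Localization.AtPrime (vertex k)` carrying exactly the transported `CommRing`,
`Algebra A _`, `IsLocalization.AtPrime _ 𝔪` and `IsLocalRing` structure (kept irreducible for instance search, so that
the localization `(A_𝔪)_{𝔭'}` below is one layer deep). -/
def VertexLocalRing : Type := Localization.AtPrime (vertex k)

/-- transported ring structure -/
instance VertexLocalRing.instCommRing : CommRing (VertexLocalRing k) :=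
  inferInstanceAs (CommRing (Localization.AtPrime (vertex k)))

/-- transported `A`-algebra structure -/
instance VertexLocalRing.instAlgebra : Algebra (ConeRing k) (VertexLocalRing k) :=
  inferInstanceAs (Algebra (ConeRing k) (Localization.AtPrime (vertex k)))

/-- `A_𝔪` is the localization of `A` at the vertex. -/
instance VertexLocalRing.instIsLocalizationAtPrime : IsLocalization.AtPrime (VertexLocalRing k) (vertex k) :=
  inferInstanceAs (IsLocalization.AtPrime (Localization.AtPrime (vertex k)) (vertex k))

/-- `A_𝔪` is local. -/
instance VertexLocalRing.instIsLocalRing : IsLocalRing (VertexLocalRing k) :=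
  IsLocalization.AtPrime.isLocalRing (VertexLocalRing k) (vertex k)

/-- [OURS] The ruling prime pushed forward to the vertex local ring, `𝔭' = 𝔭·A_𝔪`. -/
def rulingAtVertex : Ideal (VertexLocalRing k) := (ruling k).map (algebraMap (ConeRing k) (VertexLocalRing k))

/-- `A ∖ 𝔪` misses `𝔭` (since `𝔭 ≤ 𝔪`). -/
theorem disjoint_primeCompl_vertex_ruling :
    Disjoint ((vertex k).primeCompl : Set (ConeRing k)) (ruling k : Set (ConeRing k)) := by
  rw [Set.disjoint_left]
  intro a ha hmem
  exact ha (ruling_le_vertex k hmem)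

/-- `𝔭'` is a prime of `A_𝔪`. -/
instance rulingAtVertex_isPrime : (rulingAtVertex k).IsPrime :=
  IsLocalization.isPrime_of_isPrime_disjoint (vertex k).primeCompl (VertexLocalRing k) (ruling k) inferInstance
    (disjoint_primeCompl_vertex_ruling k)

/-- `𝔭'` contracts to `𝔭`. -/
theorem under_rulingAtVertex : (rulingAtVertex k).under (ConeRing k) = ruling k :=
  IsLocalization.under_map_of_isPrime_disjoint (vertex k).primeCompl (VertexLocalRing k) inferInstance
    (disjoint_primeCompl_vertex_ruling k)

/-- THE (c7)-SHAPED JUMP, UPPER END: in the generization `(A_𝔪)_{𝔭'} (= A_𝔭)` of the vertex local ring the element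
`x` has order `≥ 2`. -/
theorem x_mem_sq_atRulingAtVertex :
    algebraMap (VertexLocalRing k) (Localization.AtPrime (rulingAtVertex k))
        (algebraMap (ConeRing k) (VertexLocalRing k) (x k)) ∈
      (maximalIdeal (Localization.AtPrime (rulingAtVertex k))) ^ 2 := by
  refine algebraMap_mem_maximalIdeal_sq_of_mul_eq_sq (rulingAtVertex k) (Localization.AtPrime (rulingAtVertex k))
    (f := algebraMap (ConeRing k) (VertexLocalRing k) (x k))
    (u := algebraMap (ConeRing k) (VertexLocalRing k) (y k))
    (v := algebraMap (ConeRing k) (VertexLocalRing k) (z k)) ?_ ?_ ?_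
  · rw [← map_mul, x_mul_y, map_pow]
  · intro hy
    have hy' : y k ∈ (rulingAtVertex k).under (ConeRing k) := hy
    rw [under_rulingAtVertex] at hy'
    exact y_not_mem_ruling k hy'
  · exact Ideal.mem_map_of_mem _ (z_mem_ruling k)

/-- THE (c7)-SHAPED JUMP, LOWER END: at the vertex local ring itself `x` has order `1` (`x ∉ 𝔪²`). -/
theorem x_not_mem_sq_atVertexLocalRing :
    algebraMap (ConeRing k) (VertexLocalRing k) (x k) ∉ (maximalIdeal (VertexLocalRing k)) ^ 2 :=
  x_not_mem_sq_of_atVertex k (VertexLocalRing k)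

/-- `x ∈ 𝔪_{A_𝔪}` (order `≥ 1` at the vertex). -/
theorem x_mem_maximalIdeal_atVertexLocalRing :
    algebraMap (ConeRing k) (VertexLocalRing k) (x k) ∈ maximalIdeal (VertexLocalRing k) :=
  (IsLocalization.AtPrime.to_map_mem_maximal_iff (VertexLocalRing k) (vertex k) (x k)).mpr (x_mem_vertex k)



/-- THE JUMP IN ONE LINE: with `S := A_𝔪` (local ring of the cone at the vertex), `f := x`, `𝔭' := 𝔭·A_𝔪`:
`f ∉ 𝔪_S²` and `f ∈ 𝔪_{S_𝔭'}²` — the `𝔪`-adic order of `f` is `≤ 1` at `S` and `≥ 2` at its generization `S_𝔭'`;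
equivalently, on `Spec A` the super-level set `{2 ≤ ord(x)}` contains the generic point of the ruling `V(x, z)` but not
its specialisation, the vertex, so it is not closed. -/
theorem coneVertex_generization_jump :
    algebraMap (ConeRing k) (VertexLocalRing k) (x k) ∉ (maximalIdeal (VertexLocalRing k)) ^ 2 ∧
    algebraMap (VertexLocalRing k) (Localization.AtPrime (rulingAtVertex k))
        (algebraMap (ConeRing k) (VertexLocalRing k) (x k)) ∈
      (maximalIdeal (Localization.AtPrime (rulingAtVertex k))) ^ 2 :=
  ⟨x_not_mem_sq_atVertexLocalRing k, x_mem_sq_atRulingAtVertex k⟩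

section OrderFunction

/-! ### Read through ORDER (o11)'s `iotaOrd` (tree `WeightedInvariantIotaOrder`, res-type-073) -/

/-- `ord(x) ≥ 2` at the generization `(A_𝔪)_{𝔭'} = A_𝔭` of the vertex local ring, read through `iotaOrd`. -/
theorem two_le_iotaOrd_x_atRulingAtVertex :
    (2 : Ordinal.{0}) ≤ iotaOrd (Localization.AtPrime (rulingAtVertex k))
      (algebraMap (VertexLocalRing k) (Localization.AtPrime (rulingAtVertex k))
        (algebraMap (ConeRing k) (VertexLocalRing k) (x k))) := by
  exact_mod_cast (natCast_le_iotaOrd_iff _ _ 2).mpr (x_mem_sq_atRulingAtVertex k)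

/-- `ord(x) = 1` at the vertex local ring `A_𝔪`, read through `iotaOrd`. -/
theorem iotaOrd_x_atVertex :
    iotaOrd (VertexLocalRing k) (algebraMap (ConeRing k) (VertexLocalRing k) (x k)) = 1 := by
  exact_mod_cast (iotaOrd_eq_natCast_iff _ _ 1).mpr
    ⟨by simpa only [pow_one] using x_mem_maximalIdeal_atVertexLocalRing k, x_not_mem_sq_atVertexLocalRing k⟩

/-- THE REGULARITY HYPOTHESIS OF (c7) IS NECESSARY FOR `iotaOrd`: the ALL-RINGS form of the generization clause
(«`ι (S_𝔭) f ≤ ι S f` for ALL commutative rings `S`» — the first typing of (c7), before the restriction to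
`[IsRegularLocalRing S]` in the tree's `IotaGenerizationMonotone`; written out below, nothing re-declared) fails for
`iotaOrd`: witness the quadric cone over `ℚ`, `S = A_𝔪`, `𝔭 = 𝔭·A_𝔪`, `f = x`, where `iotaOrd (S_𝔭) f ≥ 2 > 1 = iotaOrd S f`
— while the tree's restricted clause holds (`iotaOrd_generizationMonotone`, res-type-073). -/
theorem not_generizationMonotone_allRings_iotaOrd :
    ¬ (∀ (S : Type) [CommRing S] (𝔭 : Ideal S) [𝔭.IsPrime] (f : S),
        iotaOrd (Localization.AtPrime 𝔭) (algebraMap S (Localization.AtPrime 𝔭) f) ≤ iotaOrd S f) := by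
  intro hmono
  have h := (two_le_iotaOrd_x_atRulingAtVertex ℚ).trans
    (hmono (VertexLocalRing ℚ) (rulingAtVertex ℚ) (algebraMap (ConeRing ℚ) (VertexLocalRing ℚ) (x ℚ)))
  rw [iotaOrd_x_atVertex] at h
  have h21 : (2 : ℕ) ≤ 1 := Nat.cast_le.mp (by exact_mod_cast h)
  omega

/-- THE VERTEX IS SINGULAR, by the order jump: `A_𝔪` is not a regular local ring (on a regular local ring the order
cannot increase under generization — `iotaOrd_generization_le_of_isRegularLocalRing` — but here it goes `1 ↦ ≥ 2`). -/
theorem not_isRegularLocalRing_vertexLocalRing : ¬ IsRegularLocalRing (VertexLocalRing k) := by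
  intro h
  have hle := (two_le_iotaOrd_x_atRulingAtVertex k).trans
    (iotaOrd_generization_le_of_isRegularLocalRing (VertexLocalRing k) (rulingAtVertex k)
      (Localization.AtPrime (rulingAtVertex k)) (algebraMap (ConeRing k) (VertexLocalRing k) (x k)))
  rw [iotaOrd_x_atVertex] at hle
  have h21 : (2 : ℕ) ≤ 1 := Nat.cast_le.mp (by exact_mod_cast hle)
  omega

end OrderFunction

end Summit.ResolutionOfSingularities.ResolutionOfSingularities.Cruxes.HypersurfaceCentreConstruction.LocalEngine.ConeSpecimen

end
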